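import Mathlib
import Literature.Probability.LatticeModels.GKSInequalities
import Literature.LinearAlgebra.Matrix.InverseMMatrixProofs
import Summits.CriticalPhenomena.Ising3DConformalLimit.Theorems.PrecisionLaplacianInverseMFerromagnetPcovOfIm
import HarnessLib

/-!
# Crux `PrecisionLaplacian.InverseMFerromagnet` (stmt-CriticalPhenomena-4798), line `Sketch` —
# stub `stub_imDeg3_of_nonadj` (C4, full subdivision)

THEOREM-ONLY file (no definitions).  Let `Σ = (⟨σ_pσ_q⟩)_{p,q}` be the spin second-moment matrix
of the zero-field pair ferromagnet `gksExpect univ K C` on `Fin n` (`K ≥ 0`, `|C i| = 2`), and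
`deg p = #{i : p ∈ C i}`.  This file proves step C4 of the line: IF `(Σ⁻¹)_xy ≤ 0` holds (in every
such system) for non-adjacent `x ≠ y` of degree `≤ 3` (H1 = conclusion of C2) and for every row of
a site of degree `≤ 2` (H2 = conclusion of C3), THEN `(Σ⁻¹)_xy ≤ 0` for all `x ≠ y` in every system
of maximal degree `≤ 3`.

Proof (full subdivision).  Write `C i = {a_i, b_i}` and subdivide every bond by a fresh site: the
new system lives on `Fin (n + m)` (old sites `Fin.castAdd m p`, fresh sites `Fin.natAdd n i`) with
`Fin (m + m)` bonds `{a_i, i'}`, `{b_i, i'}`, both with coupling `J_i = arcosh(e^{2K_i})/2 ≥ 0`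
(`cosh 2J_i = e^{2K_i}`).  Summing out a fresh spin, `∑_τ e^{Jτ(σ_a+σ_b)} = 2e^{K}·e^{Kσ_aσ_b}`
(`c4_two_site_sum`), so `⟨F⟩_new = ⟨F⟩_old` for every observable `F` of the old spins
(`c4_gksExpect_subdiv`): `Σ` is the principal submatrix of the new second-moment matrix `Σ*` on the
old sites.  `Σ*` is an inverse M-matrix: entrywise `≥ 0` (GKS I), nonsingular (positive definite,
`pcov_posDef_of_eq` of the sibling `…PcovOfIm.lean`), and `Σ*⁻¹` is a Z-matrix — two old sites are
non-adjacent and keep their degree (H1), a fresh site has degree `2` (H2 for its row, symmetry of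
`Σ*⁻¹` for its column).  By Dellacherie–Martínez–San
Martín, Lemma 2.32 (`Literature.LinearAlgebra.Matrix.principalSubmatrix_closure_holds`), principal
submatrices of inverse M-matrices are inverse M-matrices, whence `(Σ⁻¹)_xy ≤ 0`.
-/

namespace Summit.CriticalPhenomena.Ising3DConformalLimit.Cruxes.InverseMFerromagnet.PartialCovarianceLadder

open Literature.Probability.LatticeModels Finset Matrix

/-! ## The subdivision coupling: `cosh 2J = e^{2K}` -/

/-- For `K ≥ 0` there is `J ≥ 0` with `cosh 2J = e^{2K}`, namely `J = arcosh(e^{2K})/2`; written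
as `e^{2J} + e^{-2J} = 2e^{2K}`. [folklore] -/
theorem c4_exists_coupling {K : ℝ} (hK : 0 ≤ K) :
    ∃ J : ℝ, 0 ≤ J ∧ Real.exp (2 * J) + Real.exp (-(2 * J)) = 2 * Real.exp (2 * K) := by
  have hc : 1 ≤ Real.exp (2 * K) := Real.one_le_exp (by positivity)
  refine ⟨Real.arcosh (Real.exp (2 * K)) / 2, div_nonneg (Real.arcosh_nonneg hc) zero_le_two, ?_⟩
  have h := Real.cosh_arcosh hc
  rw [Real.cosh_eq] at h
  rw [show 2 * (Real.arcosh (Real.exp (2 * K)) / 2) = Real.arcosh (Real.exp (2 * K)) by ring]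
  linarith

/-- **Decimation of one subdivided bond.**  If `cosh 2J = e^{2K}` then for spins `u, v = ±1`,
summing the fresh spin `τ = ±1` of the two bonds `J τ u`, `J τ v` returns the original bond up to
the constant `2e^{K}`: `e^{J(u+v)} + e^{-J(u+v)} = 2e^{K} e^{K u v}`. [folklore] -/
theorem c4_two_site_sum {K J : ℝ}
    (hJ : Real.exp (2 * J) + Real.exp (-(2 * J)) = 2 * Real.exp (2 * K))
    {u v : ℝ} (hu : u = 1 ∨ u = -1) (hv : v = 1 ∨ v = -1) :
    Real.exp (J * (u + v)) + Real.exp (-(J * (u + v)))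
      = 2 * Real.exp K * Real.exp (K * (u * v)) := by
  have h2K : Real.exp (2 * K) = Real.exp K * Real.exp K := by rw [two_mul, Real.exp_add]
  have hnegK : Real.exp K * Real.exp (-K) = 1 := by
    rw [← Real.exp_add, add_neg_cancel, Real.exp_zero]
  rcases hu with rfl | rfl <;> rcases hv with rfl | rfl
  · rw [show J * (1 + 1) = 2 * J by ring, show K * (1 * 1) = K by ring, hJ, h2K]; ring
  · rw [show J * (1 + -1) = 0 by ring, show K * (1 * -1) = -K by ring, neg_zero, Real.exp_zero,
      mul_assoc, hnegK]; ring
  · rw [show J * (-1 + 1) = 0 by ring, show K * (-1 * 1) = -K by ring, neg_zero, Real.exp_zero,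
      mul_assoc, hnegK]; ring
  · rw [show J * (-1 + -1) = -(2 * J) by ring, show K * (-1 * -1) = K by ring, neg_neg, add_comm,
      hJ, h2K]; ring

/-! ## Index bookkeeping on `Fin (n + m)` (old sites `castAdd`, fresh sites `natAdd`) -/

/-- A fresh site `Fin.natAdd n i` is not an old site `Fin.castAdd m p` (their values are
`n + i ≥ n > p`). [folklore] -/
theorem c4_natAdd_ne_castAdd {n m : ℕ} (p : Fin n) (i : Fin m) :
    (Fin.natAdd n i : Fin (n + m)) ≠ Fin.castAdd m p := by
  intro h
  have h' := congrArg Fin.val h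
  simp only [Fin.val_castAdd, Fin.val_natAdd] at h'
  omega

/-- The bonds of the subdivided system have two sites. [folklore] -/
theorem c4_card_Cs {n m : ℕ} (a b : Fin m → Fin n) (Cs : Fin (m + m) → Finset (Fin (n + m)))
    (hCl : ∀ i, Cs (Fin.castAdd m i) = {Fin.castAdd m (a i), Fin.natAdd n i})
    (hCr : ∀ i, Cs (Fin.natAdd m i) = {Fin.castAdd m (b i), Fin.natAdd n i}) (j : Fin (m + m)) :
    (Cs j).card = 2 := by
  induction j using Fin.addCases with
  | left i => rw [hCl]; exact Finset.card_pair (c4_natAdd_ne_castAdd _ _).symm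
  | right i => rw [hCr]; exact Finset.card_pair (c4_natAdd_ne_castAdd _ _).symm

/-- Two distinct old sites are non-adjacent in the subdivided system (every new bond contains
exactly one old site). [folklore] -/
theorem c4_nonadj {n m : ℕ} (a b : Fin m → Fin n) (Cs : Fin (m + m) → Finset (Fin (n + m)))
    (hCl : ∀ i, Cs (Fin.castAdd m i) = {Fin.castAdd m (a i), Fin.natAdd n i})
    (hCr : ∀ i, Cs (Fin.natAdd m i) = {Fin.castAdd m (b i), Fin.natAdd n i})
    {r r' : Fin n} (hrr : r ≠ r') (j : Fin (m + m)) :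
    ¬ (Fin.castAdd m r ∈ Cs j ∧ Fin.castAdd m r' ∈ Cs j) := by
  induction j using Fin.addCases with
  | left i =>
    simp only [hCl, Finset.mem_insert, Finset.mem_singleton, Fin.castAdd_inj,
      (c4_natAdd_ne_castAdd _ _).symm, or_false]
    exact fun h => hrr (h.1.trans h.2.symm)
  | right i =>
    simp only [hCr, Finset.mem_insert, Finset.mem_singleton, Fin.castAdd_inj,
      (c4_natAdd_ne_castAdd _ _).symm, or_false]
    exact fun h => hrr (h.1.trans h.2.symm)

/-- An old site keeps its degree in the subdivided system: `p` lies in the new bond `{a_i, i'}`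
iff `p = a_i`, in `{b_i, i'}` iff `p = b_i`, and `a_i ≠ b_i`. [folklore] -/
theorem c4_deg_old {n m : ℕ} (C : Fin m → Finset (Fin n)) (a b : Fin m → Fin n)
    (hab : ∀ i, a i ≠ b i) (hCab : ∀ i, C i = {a i, b i}) (Cs : Fin (m + m) → Finset (Fin (n + m)))
    (hCl : ∀ i, Cs (Fin.castAdd m i) = {Fin.castAdd m (a i), Fin.natAdd n i})
    (hCr : ∀ i, Cs (Fin.natAdd m i) = {Fin.castAdd m (b i), Fin.natAdd n i}) (r : Fin n) :
    (Finset.univ.filter (fun j => Fin.castAdd m r ∈ Cs j)).card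
      = (Finset.univ.filter (fun i => r ∈ C i)).card := by
  rw [Finset.card_filter, Finset.card_filter, Fin.sum_univ_add, ← Finset.sum_add_distrib]
  refine Finset.sum_congr rfl fun i _ => ?_
  simp only [hCl, hCr, hCab, Finset.mem_insert, Finset.mem_singleton, Fin.castAdd_inj,
    (c4_natAdd_ne_castAdd _ _).symm, or_false]
  by_cases h1 : r = a i <;> by_cases h2 : r = b i
  · exact absurd (h1.symm.trans h2) (hab i)
  · rw [if_pos h1, if_neg h2, if_pos (Or.inl h1)]
  · rw [if_neg h1, if_pos h2, if_pos (Or.inr h2)]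
  · rw [if_neg h1, if_neg h2, if_neg (not_or.2 ⟨h1, h2⟩)]

/-- A fresh site has degree (at most) `2` in the subdivided system. [folklore] -/
theorem c4_deg_fresh {n m : ℕ} (a b : Fin m → Fin n) (Cs : Fin (m + m) → Finset (Fin (n + m)))
    (hCl : ∀ i, Cs (Fin.castAdd m i) = {Fin.castAdd m (a i), Fin.natAdd n i})
    (hCr : ∀ i, Cs (Fin.natAdd m i) = {Fin.castAdd m (b i), Fin.natAdd n i}) (i₀ : Fin m) :
    (Finset.univ.filter (fun j => Fin.natAdd n i₀ ∈ Cs j)).card ≤ 2 := by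
  rw [Finset.card_filter, Fin.sum_univ_add]
  simp only [hCl, hCr, Finset.mem_insert, Finset.mem_singleton, Fin.natAdd_inj,
    c4_natAdd_ne_castAdd, false_or]
  simp

/-! ## The marginal identity: summing out the fresh spins -/

/-- The Boltzmann weight of the subdivided system at the configuration `(σ, τ)` (old spins `σ`,
fresh spins `τ`) factorises over the old bonds: `∏_i e^{J_i τ_i (σ_{a_i} + σ_{b_i})}`. [folklore] -/
theorem c4_gksWeight_append {n m : ℕ} (J : Fin m → ℝ) (a b : Fin m → Fin n)
    (Ks : Fin (m + m) → ℝ) (hKl : ∀ i, Ks (Fin.castAdd m i) = J i)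
    (hKr : ∀ i, Ks (Fin.natAdd m i) = J i) (Cs : Fin (m + m) → Finset (Fin (n + m)))
    (hCl : ∀ i, Cs (Fin.castAdd m i) = {Fin.castAdd m (a i), Fin.natAdd n i})
    (hCr : ∀ i, Cs (Fin.natAdd m i) = {Fin.castAdd m (b i), Fin.natAdd n i})
    (σ : SpinConfig (Fin n)) (τ : SpinConfig (Fin m)) :
    gksWeight Finset.univ Ks Cs (Fin.append σ τ)
      = ∏ i, Real.exp (J i * spinAt i τ * (spinAt (a i) σ + spinAt (b i) σ)) := by
  rw [gksWeight, gksHamiltonian, Fin.sum_univ_add, ← Finset.sum_add_distrib, Real.exp_sum]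
  refine Finset.prod_congr rfl fun i _ => ?_
  rw [hKl, hKr, hCl, hCr, spinProduct, spinProduct,
    Finset.prod_pair (c4_natAdd_ne_castAdd _ _).symm,
    Finset.prod_pair (c4_natAdd_ne_castAdd _ _).symm]
  simp only [spinAt, Fin.append_left, Fin.append_right]
  congr 1
  ring

/-- **Summing out the fresh spins.**  With `cosh 2J_i = e^{2K_i}` and `C i = {a_i, b_i}`:
`∑_τ w_new(σ, τ) = (∏_i 2e^{K_i}) · w_old(σ)`. [folklore] -/
theorem c4_sum_gksWeight_append {n m : ℕ} (K J : Fin m → ℝ) (C : Fin m → Finset (Fin n))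
    (a b : Fin m → Fin n) (hab : ∀ i, a i ≠ b i) (hCab : ∀ i, C i = {a i, b i})
    (hJ : ∀ i, Real.exp (2 * J i) + Real.exp (-(2 * J i)) = 2 * Real.exp (2 * K i))
    (Ks : Fin (m + m) → ℝ) (hKl : ∀ i, Ks (Fin.castAdd m i) = J i)
    (hKr : ∀ i, Ks (Fin.natAdd m i) = J i) (Cs : Fin (m + m) → Finset (Fin (n + m)))
    (hCl : ∀ i, Cs (Fin.castAdd m i) = {Fin.castAdd m (a i), Fin.natAdd n i})
    (hCr : ∀ i, Cs (Fin.natAdd m i) = {Fin.castAdd m (b i), Fin.natAdd n i})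
    (σ : SpinConfig (Fin n)) :
    ∑ τ : SpinConfig (Fin m), gksWeight Finset.univ Ks Cs (Fin.append σ τ)
      = (∏ i, 2 * Real.exp (K i)) * gksWeight Finset.univ K C σ := by
  simp_rw [c4_gksWeight_append J a b Ks hKl hKr Cs hCl hCr σ]
  have hswap : ∑ τ : SpinConfig (Fin m),
        ∏ i, Real.exp (J i * spinAt i τ * (spinAt (a i) σ + spinAt (b i) σ))
      = ∏ i, ∑ u : ℤˣ, Real.exp (J i * (((u : ℤ)) : ℝ) * (spinAt (a i) σ + spinAt (b i) σ)) := by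
    rw [Fintype.prod_sum]
    rfl
  rw [hswap]
  have hfac : ∀ i, ∑ u : ℤˣ, Real.exp (J i * (((u : ℤ)) : ℝ) * (spinAt (a i) σ + spinAt (b i) σ))
      = 2 * Real.exp (K i) * Real.exp (K i * (spinAt (a i) σ * spinAt (b i) σ)) := by
    intro i
    rw [UnitsInt.univ, Finset.sum_pair (by decide : (1 : ℤˣ) ≠ -1)]
    simp only [Units.val_one, Units.val_neg, Int.cast_one, Int.cast_neg, mul_one, mul_neg_one,
      neg_mul]
    exact c4_two_site_sum (hJ i) (spinAt_eq_one_or_eq_neg_one _ _)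
      (spinAt_eq_one_or_eq_neg_one _ _)
  simp_rw [hfac]
  rw [Finset.prod_mul_distrib, gksWeight, gksHamiltonian, Real.exp_sum]
  congr 1
  refine Finset.prod_congr rfl fun i _ => ?_
  rw [hCab i, spinProduct, Finset.prod_pair (hab i)]

/-- **Marginal identity, unnormalised.**  For every observable `F` of the old spins,
`Z_new ⟨F⟩_new = (∏_i 2e^{K_i}) · Z_old ⟨F⟩_old` (the configuration sum over `Fin (n+m) → ℤˣ`
is the sum over pairs `(σ, τ)` along `Fin.appendEquiv`, and the `τ`-sum is
`c4_sum_gksWeight_append`). [folklore] -/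
theorem c4_gksSum_subdiv {n m : ℕ} (K J : Fin m → ℝ) (C : Fin m → Finset (Fin n))
    (a b : Fin m → Fin n) (hab : ∀ i, a i ≠ b i) (hCab : ∀ i, C i = {a i, b i})
    (hJ : ∀ i, Real.exp (2 * J i) + Real.exp (-(2 * J i)) = 2 * Real.exp (2 * K i))
    (Ks : Fin (m + m) → ℝ) (hKl : ∀ i, Ks (Fin.castAdd m i) = J i)
    (hKr : ∀ i, Ks (Fin.natAdd m i) = J i) (Cs : Fin (m + m) → Finset (Fin (n + m)))
    (hCl : ∀ i, Cs (Fin.castAdd m i) = {Fin.castAdd m (a i), Fin.natAdd n i})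
    (hCr : ∀ i, Cs (Fin.natAdd m i) = {Fin.castAdd m (b i), Fin.natAdd n i})
    (F : SpinConfig (Fin n) → ℝ) :
    gksSum Finset.univ Ks Cs (fun ω => F (fun p => ω (Fin.castAdd m p)))
      = (∏ i, 2 * Real.exp (K i)) * gksSum Finset.univ K C F := by
  have h1 : ∑ ω : SpinConfig (Fin (n + m)),
        F (fun p => ω (Fin.castAdd m p)) * gksWeight Finset.univ Ks Cs ω
      = ∑ στ : SpinConfig (Fin n) × SpinConfig (Fin m),
          F στ.1 * gksWeight Finset.univ Ks Cs (Fin.append στ.1 στ.2) :=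
    Fintype.sum_equiv (Fin.appendEquiv n m).symm _ _
      (fun ω => by simp only [Fin.appendEquiv_symm_apply, Fin.append_castAdd_natAdd])
  have h2 : ∑ στ : SpinConfig (Fin n) × SpinConfig (Fin m),
        F στ.1 * gksWeight Finset.univ Ks Cs (Fin.append στ.1 στ.2)
      = ∑ σ : SpinConfig (Fin n), ∑ τ : SpinConfig (Fin m),
          F σ * gksWeight Finset.univ Ks Cs (Fin.append σ τ) :=
    Fintype.sum_prod_type' (fun σ τ => F σ * gksWeight Finset.univ Ks Cs (Fin.append σ τ))
  simp only [gksSum]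
  rw [h1, h2, Finset.mul_sum]
  refine Finset.sum_congr rfl fun σ _ => ?_
  rw [← Finset.mul_sum, c4_sum_gksWeight_append K J C a b hab hCab hJ Ks hKl hKr Cs hCl hCr σ]
  ring

/-- **Marginal identity.**  For every observable `F` of the old spins, `⟨F⟩_new = ⟨F⟩_old`: the
law of the old spins under the subdivided ferromagnet is the original ferromagnet. [folklore] -/
theorem c4_gksExpect_subdiv {n m : ℕ} (K J : Fin m → ℝ) (C : Fin m → Finset (Fin n))
    (a b : Fin m → Fin n) (hab : ∀ i, a i ≠ b i) (hCab : ∀ i, C i = {a i, b i})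
    (hJ : ∀ i, Real.exp (2 * J i) + Real.exp (-(2 * J i)) = 2 * Real.exp (2 * K i))
    (Ks : Fin (m + m) → ℝ) (hKl : ∀ i, Ks (Fin.castAdd m i) = J i)
    (hKr : ∀ i, Ks (Fin.natAdd m i) = J i) (Cs : Fin (m + m) → Finset (Fin (n + m)))
    (hCl : ∀ i, Cs (Fin.castAdd m i) = {Fin.castAdd m (a i), Fin.natAdd n i})
    (hCr : ∀ i, Cs (Fin.natAdd m i) = {Fin.castAdd m (b i), Fin.natAdd n i})
    (F : SpinConfig (Fin n) → ℝ) :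
    gksExpect Finset.univ Ks Cs (fun ω => F (fun p => ω (Fin.castAdd m p)))
      = gksExpect Finset.univ K C F := by
  have hA : (∏ i : Fin m, 2 * Real.exp (K i)) ≠ 0 :=
    Finset.prod_ne_zero_iff.2 fun i _ => by positivity
  have h1 : gksSum Finset.univ Ks Cs (fun _ => (1 : ℝ))
      = (∏ i, 2 * Real.exp (K i)) * gksSum Finset.univ K C (fun _ => 1) :=
    c4_gksSum_subdiv K J C a b hab hCab hJ Ks hKl hKr Cs hCl hCr (fun _ => (1 : ℝ))
  unfold gksExpect
  rw [c4_gksSum_subdiv K J C a b hab hCab hJ Ks hKl hKr Cs hCl hCr F, h1]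
  exact mul_div_mul_left _ _ hA

/-! ## The registered stub -/

/-- Registered stub `stub_imDeg3_of_nonadj` (C4 of line `Sketch`, full subdivision): if
`(Σ⁻¹)_xy ≤ 0` holds for non-adjacent pairs of degree `≤ 3` (H1) and for the rows of sites of
degree `≤ 2` (H2) in every zero-field pair ferromagnet, then `(Σ⁻¹)_xy ≤ 0` for all `x ≠ y` in
every zero-field pair ferromagnet of maximal degree `≤ 3`.  Subdivide every bond by a fresh site
with couplings `J`, `cosh 2J = e^{2K}`; the old second-moment matrix is the principal submatrix of
the new one on the old sites (`c4_gksExpect_subdiv`); the new one is an inverse M-matrix (GKS I,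
`pcov_posDef_of_eq`, H1 for two old sites via `c4_nonadj`/`c4_deg_old`, H2 and symmetry for a fresh
site via `c4_deg_fresh`); conclude by DMS Lemma 2.32 (`principalSubmatrix_closure_holds`).
[folklore] -/
theorem stub_imDeg3_of_nonadj : (∀ (n m : ℕ) (K : Fin m → ℝ) (C : Fin m → Finset (Fin n)), (∀ i, 0 ≤ K i) → (∀ i, (C i).card = 2) → ∀ x y : Fin n, x ≠ y → (∀ i, ¬ (x ∈ C i ∧ y ∈ C i)) → (Finset.univ.filter (fun i => x ∈ C i)).card ≤ 3 → (Finset.univ.filter (fun i => y ∈ C i)).card ≤ 3 → (Matrix.of fun p q : Fin n => gksExpect Finset.univ K C (fun ω => spinAt p ω * spinAt q ω))⁻¹ x y ≤ 0) → (∀ (n m : ℕ) (K : Fin m → ℝ) (C : Fin m → Finset (Fin n)), (∀ i, 0 ≤ K i) → (∀ i, (C i).card = 2) → ∀ z y : Fin n, z ≠ y → (Finset.univ.filter (fun i => z ∈ C i)).card ≤ 2 → (Matrix.of fun p q : Fin n => gksExpect Finset.univ K C (fun ω => spinAt p ω * spinAt q ω))⁻¹ z y ≤ 0) → ∀ (n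 m : ℕ) (K : Fin m → ℝ) (C : Fin m → Finset (Fin n)), (∀ i, 0 ≤ K i) → (∀ i, (C i).card = 2) → (∀ p : Fin n, (Finset.univ.filter (fun i => p ∈ C i)).card ≤ 3) → ∀ x y : Fin n, x ≠ y → (Matrix.of fun p q : Fin n => gksExpect Finset.univ K C (fun ω => spinAt p ω * spinAt q ω))⁻¹ x y ≤ 0 := by
  intro H1 H2 n m K C hK hC hdeg x y hxy
  -- endpoints of the bonds: `C i = {a i, b i}`, `a i ≠ b i`
  choose a b hab hCab using fun i => Finset.card_eq_two.1 (hC i)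
  -- subdivision couplings: `cosh 2J_i = e^{2K_i}`, `J_i ≥ 0`
  choose J hJ0 hJ using fun i => c4_exists_coupling (hK i)
  -- the subdivided system on `Fin (n + m)` sites with `Fin (m + m)` bonds
  obtain ⟨Ks, hKl, hKr⟩ : ∃ Ks : Fin (m + m) → ℝ,
      (∀ i, Ks (Fin.castAdd m i) = J i) ∧ (∀ i, Ks (Fin.natAdd m i) = J i) :=
    ⟨Fin.append J J, fun i => Fin.append_left J J i, fun i => Fin.append_right J J i⟩
  obtain ⟨Cs, hCl, hCr⟩ : ∃ Cs : Fin (m + m) → Finset (Fin (n + m)),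
      (∀ i, Cs (Fin.castAdd m i) = {Fin.castAdd m (a i), Fin.natAdd n i}) ∧
        (∀ i, Cs (Fin.natAdd m i) = {Fin.castAdd m (b i), Fin.natAdd n i}) :=
    ⟨Fin.append (fun i => {Fin.castAdd m (a i), Fin.natAdd n i})
        (fun i => {Fin.castAdd m (b i), Fin.natAdd n i}),
      fun i => Fin.append_left _ _ i, fun i => Fin.append_right _ _ i⟩
  have hKs0 : ∀ j, 0 ≤ Ks j := fun j =>
    Fin.addCases (fun i => by rw [hKl]; exact hJ0 i) (fun i => by rw [hKr]; exact hJ0 i) j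
  have hCs2 : ∀ j, (Cs j).card = 2 := c4_card_Cs a b Cs hCl hCr
  -- the second-moment matrix `Σ*` of the subdivided system
  obtain ⟨Gs, hGs⟩ : ∃ Gs : Matrix (Fin (n + m)) (Fin (n + m)) ℝ,
      Gs = Matrix.of (fun p q : Fin (n + m) =>
        gksExpect Finset.univ Ks Cs (fun ω => spinAt p ω * spinAt q ω)) := ⟨_, rfl⟩
  have hPD : Gs.PosDef := pcov_posDef_of_eq hGs
  have hsymm : ∀ p q, Gs⁻¹ p q = Gs⁻¹ q p := fun p q => by
    have h := hPD.inv.isHermitian.apply q p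
    simpa using h
  -- `Σ*` is an inverse M-matrix
  have hIM : Literature.LinearAlgebra.Matrix.IsInverseMMatrix Gs := by
    refine ⟨fun p q => ?_, (Matrix.isUnit_iff_isUnit_det Gs).mp hPD.isUnit, fun p q hpq => ?_⟩
    · rw [hGs, Matrix.of_apply]
      by_cases hpq : p = q
      · subst hpq
        have h1 := (gksSum_one_pos Finset.univ Ks Cs).ne'
        simp only [spinAt_mul_self, gksExpect, div_self h1, zero_le_one]
      · rw [show (fun ω : SpinConfig (Fin (n + m)) => spinAt p ω * spinAt q ω) = spinProduct {p, q}
            from funext fun ω => by rw [spinProduct, Finset.prod_pair hpq]]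
        exact gksExpect_spinProduct_nonneg _ _ _ (fun j _ => hKs0 j) _
    · induction p using Fin.addCases with
      | right i =>
        -- the row of a fresh site (degree `2`): H2
        rw [hGs]
        exact H2 (n + m) (m + m) Ks Cs hKs0 hCs2 _ q hpq (c4_deg_fresh a b Cs hCl hCr i)
      | left r =>
        induction q using Fin.addCases with
        | right i =>
          -- the column of a fresh site: symmetry and H2
          rw [hsymm, hGs]
          exact H2 (n + m) (m + m) Ks Cs hKs0 hCs2 _ _ (Ne.symm hpq)
            (c4_deg_fresh a b Cs hCl hCr i)
        | left r' =>
          -- two old sites: non-adjacent, degrees `≤ 3`: H1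
          have hrr : r ≠ r' := fun h => hpq (by rw [h])
          rw [hGs]
          refine H1 (n + m) (m + m) Ks Cs hKs0 hCs2 _ _ hpq (c4_nonadj a b Cs hCl hCr hrr) ?_ ?_
          · rw [c4_deg_old C a b hab hCab Cs hCl hCr r]
            exact hdeg r
          · rw [c4_deg_old C a b hab hCab Cs hCl hCr r']
            exact hdeg r'
  -- DMS Lemma 2.32: the principal submatrix on the old sites is an inverse M-matrix …
  have hcl := (Literature.LinearAlgebra.Matrix.principalSubmatrix_closure_holds (Fin (n + m))
    (Fin n) Gs (Fin.castAddEmb m)).1 hIM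
  -- … and it is `Σ`, by the marginal identity
  have hsub : Gs.submatrix (Fin.castAddEmb m) (Fin.castAddEmb m)
      = Matrix.of (fun p q : Fin n =>
          gksExpect Finset.univ K C (fun ω => spinAt p ω * spinAt q ω)) := by
    ext p q
    simp only [Matrix.submatrix_apply, hGs, Matrix.of_apply, Fin.coe_castAddEmb]
    exact c4_gksExpect_subdiv K J C a b hab hCab hJ Ks hKl hKr Cs hCl hCr
      (fun ω => spinAt p ω * spinAt q ω)
  rw [hsub] at hcl
  exact hcl.2.2 x y hxy

end Summit.CriticalPhenomena.Ising3DConformalLimit.Cruxes.InverseMFerromagnet.PartialCovarianceLadder
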